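import Mathlib
import Summits.ValiantsHypothesis.ValiantsHypothesis.Theorems.KPlusLogSqLawLiftingPatchworkCoefficients

/-!
# Patchworking at FINITE base, part 1: dominance margins of a tropical design ⇒ archimedean monomial dominance

HONEST FRAMING.  Helper file toward the lifting crux `WeakLifting` (stmt-ValiantsHypothesis-19561; aside `Lifting`
stmt-ValiantsHypothesis-19772, registered stub `stub_liftThin`) of route `KPlusLogSqLaw` (cell `pub-symmetroid`, seat
val-sym-lift-p1 g9, 2026-08-27).  Bookkeeping for the patchworked pencil of ONE tropical design at finite base; nothing here asserts
`WeakLifting`, `TropicalB`, Conjecture B, `MatrixDescartes` (stmt-ValiantsHypothesis-18050) or anything about VP ≠ VNP.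

SETTING (tree vocabulary of `…MatrixDescartes.Negative`).  A design `(d, v, ε)` of format `(m, K)` (`|ε| ≤ 1`), a base `b > 1`, the
patchworked pencil `F_b = Σ_l X^{d_l} · patchMatrix b v ε l` and `f_b = det F_b = Σ_s c_s(b) X^s`, with merged coefficients
`c_s(b) = Σ_{D(q) = s} termSign(q) b^{−V(q)}` over the Leibniz terms `q = (σ, λ)` (`D(q) = Σᵢ d(λᵢ)` the slope,
`V(q) = Σᵢ v(σᵢ, i, λᵢ)`; `ExactPatchwork.coeff_det_patch`).  `N = m!·K^m` is the number of Leibniz terms.  A term `p` is DOMINANT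
WITH MARGIN `M` at the integer slope `θ` if it is present and `tropWeight θ q + M ≤ tropWeight θ p` for every other present term `q`
(the tree's `IsDominant` is margin `1`: `margin_one_of_isDominant`, `isDominant_of_margin`).

RESULTS (all under `N ≤ b^M`, i.e. base `b ≥ N^{1/M}` — the margin buys the base):
* `sum_competitors_lt_of_margin` — at `x = b^θ` all other terms together weigh less than the dominant one (`(N−1) b^{W−M} < b^W`);
* `termSign_mul_eval_pos_of_margin` — `f_b(b^θ)` has the sign `termSign p` (the tree's `det_patch_sign` is the case `M = 1`, `b > N`);
* `coeff_mul_pow_eq_of_slope`, `termSign_mul_coeff_pos_of_margin` — the merged coefficient `c_{D(p)}(b)` has the sign `termSign p`;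
* `monomial_dominant_of_margin` — the MONOMIAL `x^{D(p)}` archimedean-dominates `f_b` at `x = b^θ`:
  `Σ_{s ≠ D(p)} |c_s(b)| x^s < |c_{D(p)}(b)| x^{D(p)}` — exactly the hypothesis shape of the local Descartes rule
  (`LocalDescartes.card_roots_Ioo_le_signVar_coeffs`) and of lift-p2's Newton-window lemmas;
* `slope_le_of_margin` — slopes of margin-dominant terms increase with `θ`.
Part 2 (`…LiftingFiniteBasePatchwork`) turns these into window-by-window root counts.  No `def`.  [folklore] (quantitative
one-variable Viro patchworking.)
-/

set_option linter.dupNamespace false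
set_option autoImplicit false

namespace Summit.ValiantsHypothesis.ValiantsHypothesis.Theorems.KPlusLogSqLaw.LocalDescartes

open Polynomial Finset
open scoped BigOperators
open Summit.ValiantsHypothesis.ValiantsHypothesis.Theorems.MatrixDescartes.Negative
  (patchMatrix tropWeight termSign IsDominant abs_termSign_eq_one det_patch_eq_sum)
open Summit.ValiantsHypothesis.ValiantsHypothesis.Theorems.KPlusLogSqLaw.ExactPatchwork
  (coeff_det_patch_eq_sum_filter weighted_mass_le_sum_terms zpow_neg_mul_pow_eq)

variable {m K : ℕ}

/-! ## Margins -/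

/-- the tree's `IsDominant` is dominance with margin `1` (integer weights). -/
theorem margin_one_of_isDominant (d : Fin K → ℕ) (v ε : Fin m → Fin m → Fin K → ℤ) (θ : ℤ)
    (p : Equiv.Perm (Fin m) × (Fin m → Fin K)) (hp : IsDominant d v ε θ p) :
    termSign ε p ≠ 0 ∧ ∀ q, q ≠ p → termSign ε q ≠ 0 → tropWeight d v θ q + ((1 : ℕ) : ℤ) ≤ tropWeight d v θ p :=
  ⟨hp.1, fun q hq hqz => by have := hp.2 q hq hqz; push_cast; omega⟩

/-- dominance with a positive margin is the tree's `IsDominant`. -/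
theorem isDominant_of_margin (d : Fin K → ℕ) (v ε : Fin m → Fin m → Fin K → ℤ) (θ : ℤ) {M : ℕ} (hM : 1 ≤ M)
    (p : Equiv.Perm (Fin m) × (Fin m → Fin K)) (hp : termSign ε p ≠ 0)
    (hmar : ∀ q, q ≠ p → termSign ε q ≠ 0 → tropWeight d v θ q + M ≤ tropWeight d v θ p) :
    IsDominant d v ε θ p :=
  ⟨hp, fun q hq hqz => by have := hmar q hq hqz; have hM' : (1 : ℤ) ≤ (M : ℤ) := (by exact_mod_cast hM); omega⟩

/-- the archimedean mass of a term at `x = b^θ` is `b^{tropWeight}`. [folklore] -/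
theorem zpow_neg_mul_zpow_pow_eq (b : ℝ) (hb : 0 < b) (d : Fin K → ℕ) (v : Fin m → Fin m → Fin K → ℤ) (θ : ℤ)
    (q : Equiv.Perm (Fin m) × (Fin m → Fin K)) :
    b ^ (-(∑ i, v (q.1 i) i (q.2 i))) * (b ^ θ) ^ (∑ i, d (q.2 i)) = b ^ tropWeight d v θ q := by
  have := zpow_neg_mul_pow_eq b hb d v θ 1 q
  rw [mul_one, one_pow, mul_one] at this
  exact this

/-- **All competitors together weigh less than the margin-dominant term** at `x = b^θ`, as soon as `N ≤ b^M`. [folklore] -/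
theorem sum_competitors_lt_of_margin (b : ℝ) (hb : 1 < b) (d : Fin K → ℕ) (v ε : Fin m → Fin m → Fin K → ℤ)
    (hε : ∀ i j l, (ε i j l).natAbs ≤ 1) (θ : ℤ) (M : ℕ) (p : Equiv.Perm (Fin m) × (Fin m → Fin K))
    (hmar : ∀ q, q ≠ p → termSign ε q ≠ 0 → tropWeight d v θ q + M ≤ tropWeight d v θ p)
    (hN : (Fintype.card (Equiv.Perm (Fin m) × (Fin m → Fin K)) : ℝ) ≤ b ^ M) :
    ∑ q ∈ Finset.univ.erase p, |(termSign ε q : ℝ)| * b ^ tropWeight d v θ q < b ^ tropWeight d v θ p := by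
  classical
  have hb0 : 0 < b := lt_trans one_pos hb
  have hb1 : 1 ≤ b := hb.le
  set W := tropWeight d v θ p with hW
  set N : ℕ := Fintype.card (Equiv.Perm (Fin m) × (Fin m → Fin K)) with hNdef
  have hN1 : 1 ≤ N := Fintype.card_pos_iff.mpr ⟨p⟩
  have hterm : ∀ q ∈ Finset.univ.erase p, |(termSign ε q : ℝ)| * b ^ tropWeight d v θ q ≤ b ^ (W - M) := by
    intro q hq
    have hqp : q ≠ p := (Finset.mem_erase.mp hq).1
    by_cases hz : termSign ε q = 0
    · rw [hz, Int.cast_zero, abs_zero, zero_mul]; exact (zpow_pos hb0 _).le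
    · rw [abs_termSign_eq_one ε hε q hz, one_mul]
      exact zpow_le_zpow_right₀ hb1 (by have := hmar q hqp hz; linarith)
  have hcard : ((Finset.univ.erase p).card : ℝ) = (N : ℝ) - 1 := by
    rw [Finset.card_erase_of_mem (Finset.mem_univ p), Finset.card_univ, ← hNdef, Nat.cast_pred hN1]
  have hNM : (N : ℝ) - 1 < b ^ (M : ℤ) := by rw [zpow_natCast]; linarith
  calc ∑ q ∈ Finset.univ.erase p, |(termSign ε q : ℝ)| * b ^ tropWeight d v θ q
      ≤ ∑ _q ∈ Finset.univ.erase p, b ^ (W - M) := Finset.sum_le_sum hterm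
    _ = ((N : ℝ) - 1) * b ^ (W - M) := by rw [Finset.sum_const, nsmul_eq_mul, hcard]
    _ < b ^ (M : ℤ) * b ^ (W - M) := mul_lt_mul_of_pos_right hNM (zpow_pos hb0 _)
    _ = b ^ W := by rw [← zpow_add₀ hb0.ne']; congr 1; ring

/-- **Sign of the determinant at a margin-dominance slope** (`det_patch_sign` for margin `M` and base `b^M ≥ N`):
`termSign p · f_b(b^θ) > 0`. [folklore] -/
theorem termSign_mul_eval_pos_of_margin (b : ℝ) (hb : 1 < b) (d : Fin K → ℕ) (v ε : Fin m → Fin m → Fin K → ℤ)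
    (hε : ∀ i j l, (ε i j l).natAbs ≤ 1) (θ : ℤ) (M : ℕ) (p : Equiv.Perm (Fin m) × (Fin m → Fin K))
    (hp : termSign ε p ≠ 0)
    (hmar : ∀ q, q ≠ p → termSign ε q ≠ 0 → tropWeight d v θ q + M ≤ tropWeight d v θ p)
    (hN : (Fintype.card (Equiv.Perm (Fin m) × (Fin m → Fin K)) : ℝ) ≤ b ^ M) :
    0 < (termSign ε p : ℝ) * ((∑ l, (X : ℝ[X]) ^ d l • (patchMatrix b v ε l).map C).det).eval (b ^ θ) := by
  classical
  have hb0 : 0 < b := lt_trans one_pos hb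
  rw [Summit.ValiantsHypothesis.ValiantsHypothesis.Theorems.SymmetroidDescartes.eval_det_pencil,
    det_patch_eq_sum b hb0 d v ε θ, ← Finset.add_sum_erase _ _ (Finset.mem_univ p), mul_add]
  have hs1 : (termSign ε p : ℝ) * (termSign ε p : ℝ) = 1 := by
    have h := abs_termSign_eq_one ε hε p hp
    rcases abs_eq (zero_le_one) |>.mp h with h1 | h1 <;> rw [h1] <;> norm_num
  have hmain : (termSign ε p : ℝ) * ((termSign ε p : ℝ) * b ^ tropWeight d v θ p) = b ^ tropWeight d v θ p := by
    rw [← mul_assoc, hs1, one_mul]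
  have hrest : |(termSign ε p : ℝ) * ∑ q ∈ Finset.univ.erase p, (termSign ε q : ℝ) * b ^ tropWeight d v θ q|
      < b ^ tropWeight d v θ p := by
    rw [abs_mul, abs_termSign_eq_one ε hε p hp, one_mul]
    refine lt_of_le_of_lt (Finset.abs_sum_le_sum_abs _ _) ?_
    refine lt_of_le_of_lt (le_of_eq (Finset.sum_congr rfl fun q _ => ?_))
      (sum_competitors_lt_of_margin b hb d v ε hε θ M p hmar hN)
    rw [abs_mul, abs_of_pos (zpow_pos hb0 _)]
  rw [hmain]
  have := neg_abs_le ((termSign ε p : ℝ) * ∑ q ∈ Finset.univ.erase p, (termSign ε q : ℝ) * b ^ tropWeight d v θ q)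
  linarith

/-- the merged coefficient of the slope `D(p)`, scaled to `x = b^θ`, is the dominant term plus its slope-class competitors.
[folklore] -/
theorem coeff_mul_pow_eq_of_slope (b : ℝ) (hb : 0 < b) (d : Fin K → ℕ) (v ε : Fin m → Fin m → Fin K → ℤ) (θ : ℤ)
    (p : Equiv.Perm (Fin m) × (Fin m → Fin K)) :
    ((∑ l, (X : ℝ[X]) ^ d l • (patchMatrix b v ε l).map C).det).coeff (∑ i, d (p.2 i)) * (b ^ θ) ^ (∑ i, d (p.2 i))
      = (termSign ε p : ℝ) * b ^ tropWeight d v θ p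
        + ∑ q ∈ (Finset.univ.erase p).filter (fun q => (∑ i, d (q.2 i)) = ∑ i, d (p.2 i)),
            (termSign ε q : ℝ) * b ^ tropWeight d v θ q := by
  classical
  rw [coeff_det_patch_eq_sum_filter b hb, Finset.sum_mul]
  have hp : p ∈ Finset.univ.filter (fun q : Equiv.Perm (Fin m) × (Fin m → Fin K) => (∑ i, d (q.2 i)) = ∑ i, d (p.2 i)) :=
    Finset.mem_filter.mpr ⟨Finset.mem_univ _, rfl⟩
  rw [← Finset.add_sum_erase _ _ hp, Finset.filter_erase]
  congr 1
  · rw [mul_assoc, zpow_neg_mul_zpow_pow_eq b hb d v θ p]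
  · refine Finset.sum_congr rfl fun q hq => ?_
    have hD : (∑ i, d (q.2 i)) = ∑ i, d (p.2 i) := (Finset.mem_filter.mp (Finset.mem_of_mem_erase hq)).2
    rw [mul_assoc, ← hD, zpow_neg_mul_zpow_pow_eq b hb d v θ q]

/-- **The merged coefficient at a margin-dominance slope has the sign of its term**: `termSign p · c_{D(p)}(b) > 0`. [folklore] -/
theorem termSign_mul_coeff_pos_of_margin (b : ℝ) (hb : 1 < b) (d : Fin K → ℕ) (v ε : Fin m → Fin m → Fin K → ℤ)
    (hε : ∀ i j l, (ε i j l).natAbs ≤ 1) (θ : ℤ) (M : ℕ) (p : Equiv.Perm (Fin m) × (Fin m → Fin K))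
    (hp : termSign ε p ≠ 0)
    (hmar : ∀ q, q ≠ p → termSign ε q ≠ 0 → tropWeight d v θ q + M ≤ tropWeight d v θ p)
    (hN : (Fintype.card (Equiv.Perm (Fin m) × (Fin m → Fin K)) : ℝ) ≤ b ^ M) :
    0 < (termSign ε p : ℝ) * ((∑ l, (X : ℝ[X]) ^ d l • (patchMatrix b v ε l).map C).det).coeff (∑ i, d (p.2 i)) := by
  classical
  have hb0 : 0 < b := lt_trans one_pos hb
  have hx : 0 < (b ^ θ) ^ (∑ i, d (p.2 i)) := pow_pos (zpow_pos hb0 _) _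
  suffices h : 0 < (termSign ε p : ℝ) *
      (((∑ l, (X : ℝ[X]) ^ d l • (patchMatrix b v ε l).map C).det).coeff (∑ i, d (p.2 i)) * (b ^ θ) ^ (∑ i, d (p.2 i))) by
    rw [← mul_assoc] at h
    exact pos_of_mul_pos_left h hx.le
  rw [coeff_mul_pow_eq_of_slope b hb0 d v ε θ p, mul_add]
  have hs1 : (termSign ε p : ℝ) * (termSign ε p : ℝ) = 1 := by
    have h := abs_termSign_eq_one ε hε p hp
    rcases abs_eq (zero_le_one) |>.mp h with h1 | h1 <;> rw [h1] <;> norm_num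
  rw [← mul_assoc, hs1, one_mul]
  set R := ∑ q ∈ (Finset.univ.erase p).filter (fun q => (∑ i, d (q.2 i)) = ∑ i, d (p.2 i)),
      (termSign ε q : ℝ) * b ^ tropWeight d v θ q with hR
  have hrest : |(termSign ε p : ℝ) * R| < b ^ tropWeight d v θ p := by
    rw [abs_mul, abs_termSign_eq_one ε hε p hp, one_mul, hR]
    refine lt_of_le_of_lt (Finset.abs_sum_le_sum_abs _ _) ?_
    refine lt_of_le_of_lt ?_ (sum_competitors_lt_of_margin b hb d v ε hε θ M p hmar hN)
    calc ∑ q ∈ (Finset.univ.erase p).filter (fun q => (∑ i, d (q.2 i)) = ∑ i, d (p.2 i)),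
          |(termSign ε q : ℝ) * b ^ tropWeight d v θ q|
        ≤ ∑ q ∈ Finset.univ.erase p, |(termSign ε q : ℝ) * b ^ tropWeight d v θ q| :=
          Finset.sum_le_sum_of_subset_of_nonneg (Finset.filter_subset _ _) (fun q _ _ => abs_nonneg _)
      _ = ∑ q ∈ Finset.univ.erase p, |(termSign ε q : ℝ)| * b ^ tropWeight d v θ q :=
          Finset.sum_congr rfl fun q _ => by rw [abs_mul, abs_of_pos (zpow_pos hb0 _)]
  have := neg_abs_le ((termSign ε p : ℝ) * R)
  linarith

/-- **MARGIN ⇒ MONOMIAL DOMINANCE.**  If `p` is dominant with margin `M` at the integer slope `θ` and `N ≤ b^M`, the monomial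
`x^{D(p)}` archimedean-dominates `f_b` at `x = b^θ`: `Σ_{s ≠ D(p)} |c_s(b)| x^s < |c_{D(p)}(b)| x^{D(p)}` — the hypothesis shape of the
local Descartes rule. [folklore] -/
theorem monomial_dominant_of_margin (b : ℝ) (hb : 1 < b) (d : Fin K → ℕ) (v ε : Fin m → Fin m → Fin K → ℤ)
    (hε : ∀ i j l, (ε i j l).natAbs ≤ 1) (θ : ℤ) (M : ℕ) (p : Equiv.Perm (Fin m) × (Fin m → Fin K))
    (hp : termSign ε p ≠ 0)
    (hmar : ∀ q, q ≠ p → termSign ε q ≠ 0 → tropWeight d v θ q + M ≤ tropWeight d v θ p)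
    (hN : (Fintype.card (Equiv.Perm (Fin m) × (Fin m → Fin K)) : ℝ) ≤ b ^ M) :
    ∑ s ∈ ((∑ l, (X : ℝ[X]) ^ d l • (patchMatrix b v ε l).map C).det).support.erase (∑ i, d (p.2 i)),
        |((∑ l, (X : ℝ[X]) ^ d l • (patchMatrix b v ε l).map C).det).coeff s| * (b ^ θ) ^ s
      < |((∑ l, (X : ℝ[X]) ^ d l • (patchMatrix b v ε l).map C).det).coeff (∑ i, d (p.2 i))|
          * (b ^ θ) ^ (∑ i, d (p.2 i)) := by
  classical
  have hb0 : 0 < b := lt_trans one_pos hb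
  set f := ((∑ l, (X : ℝ[X]) ^ d l • (patchMatrix b v ε l).map C).det) with hf
  set Dp := ∑ i, d (p.2 i) with hDp
  set x := b ^ θ with hx
  have hx0 : 0 ≤ x := (zpow_pos hb0 _).le
  set F : Equiv.Perm (Fin m) × (Fin m → Fin K) → ℝ := fun q => |(termSign ε q : ℝ)| * b ^ tropWeight d v θ q with hF
  -- (1) the off-slope mass is carried by the terms of other slopes
  have h1 : ∑ s ∈ f.support.erase Dp, |f.coeff s| * x ^ s
      ≤ ∑ q ∈ (Finset.univ.erase p).filter (fun q => (∑ i, d (q.2 i)) ≠ Dp), F q := by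
    have h := weighted_mass_le_sum_terms b hb0 d v ε (f.support.erase Dp) (fun _ => (1 : ℝ)) (fun _ => zero_le_one) hx0
    simp only [one_mul] at h
    have h' : ∑ q ∈ (Finset.univ : Finset (Equiv.Perm (Fin m) × (Fin m → Fin K))).filter
        (fun q => (∑ i, d (q.2 i)) ∈ f.support.erase Dp),
        |(termSign ε q : ℝ)| * b ^ (-(∑ i, v (q.1 i) i (q.2 i))) * x ^ (∑ i, d (q.2 i))
        = ∑ q ∈ (Finset.univ : Finset (Equiv.Perm (Fin m) × (Fin m → Fin K))).filter
            (fun q => (∑ i, d (q.2 i)) ∈ f.support.erase Dp), F q :=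
      Finset.sum_congr rfl fun q _ => by
        simp only [hF]
        rw [mul_assoc, hx, zpow_neg_mul_zpow_pow_eq b hb0 d v θ q]
    rw [h'] at h
    refine h.trans (Finset.sum_le_sum_of_subset_of_nonneg (fun q hq => ?_) (fun q _ _ => ?_))
    · have hq' := (Finset.mem_filter.mp hq).2
      have hne : (∑ i, d (q.2 i)) ≠ Dp := (Finset.mem_erase.mp hq').1
      refine Finset.mem_filter.mpr ⟨Finset.mem_erase.mpr ⟨fun h => hne (by rw [h]), Finset.mem_univ _⟩, hne⟩
    · simp only [hF]
      exact mul_nonneg (abs_nonneg _) (zpow_pos hb0 _).le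
  -- (2) the on-slope coefficient is the dominant term up to its slope-class competitors
  have h2 : b ^ tropWeight d v θ p - ∑ q ∈ (Finset.univ.erase p).filter (fun q => (∑ i, d (q.2 i)) = Dp), F q
      ≤ |f.coeff Dp| * x ^ Dp := by
    have hid := coeff_mul_pow_eq_of_slope b hb0 d v ε θ p
    rw [← hf, ← hDp, ← hx] at hid
    rw [← abs_of_nonneg (pow_nonneg hx0 Dp), ← abs_mul, hid]
    have hmain : |(termSign ε p : ℝ) * b ^ tropWeight d v θ p| = b ^ tropWeight d v θ p := by
      rw [abs_mul, abs_termSign_eq_one ε hε p hp, one_mul, abs_of_pos (zpow_pos hb0 _)]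
    have htri := abs_sub_abs_le_abs_add ((termSign ε p : ℝ) * b ^ tropWeight d v θ p)
      (∑ q ∈ (Finset.univ.erase p).filter (fun q => (∑ i, d (q.2 i)) = Dp), (termSign ε q : ℝ) * b ^ tropWeight d v θ q)
    have hR : |∑ q ∈ (Finset.univ.erase p).filter (fun q => (∑ i, d (q.2 i)) = Dp), (termSign ε q : ℝ) * b ^ tropWeight d v θ q|
        ≤ ∑ q ∈ (Finset.univ.erase p).filter (fun q => (∑ i, d (q.2 i)) = Dp), F q := by
      refine (Finset.abs_sum_le_sum_abs _ _).trans (le_of_eq (Finset.sum_congr rfl fun q _ => ?_))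
      simp only [hF]; rw [abs_mul, abs_of_pos (zpow_pos hb0 _)]
    rw [hmain] at htri
    linarith
  -- (3) all competitors together weigh less than the dominant term
  have h3 : ∑ q ∈ (Finset.univ.erase p).filter (fun q => (∑ i, d (q.2 i)) ≠ Dp), F q
      + ∑ q ∈ (Finset.univ.erase p).filter (fun q => (∑ i, d (q.2 i)) = Dp), F q < b ^ tropWeight d v θ p := by
    rw [add_comm, Finset.sum_filter_add_sum_filter_not]
    exact sum_competitors_lt_of_margin b hb d v ε hε θ M p hmar hN
  linarith

/-- slopes of margin-dominant terms increase with the slope parameter. [folklore] -/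
theorem slope_le_of_margin (d : Fin K → ℕ) (v ε : Fin m → Fin m → Fin K → ℤ) {θ₁ θ₂ : ℤ} (hθ : θ₁ < θ₂) (M : ℕ)
    (p₁ p₂ : Equiv.Perm (Fin m) × (Fin m → Fin K)) (hp₁ : termSign ε p₁ ≠ 0) (hp₂ : termSign ε p₂ ≠ 0)
    (hmar₁ : ∀ q, q ≠ p₁ → termSign ε q ≠ 0 → tropWeight d v θ₁ q + M ≤ tropWeight d v θ₁ p₁)
    (hmar₂ : ∀ q, q ≠ p₂ → termSign ε q ≠ 0 → tropWeight d v θ₂ q + M ≤ tropWeight d v θ₂ p₂) :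
    (∑ i, d (p₁.2 i)) ≤ ∑ i, d (p₂.2 i) := by
  by_cases heq : p₁ = p₂
  · rw [heq]
  have h1 := hmar₁ p₂ (Ne.symm heq) hp₂
  have h2 := hmar₂ p₁ heq hp₁
  unfold tropWeight at h1 h2
  set S₁ := ∑ i, (d (p₁.2 i) : ℤ) with hS₁
  set S₂ := ∑ i, (d (p₂.2 i) : ℤ) with hS₂
  have hM : (0 : ℤ) ≤ M := Int.natCast_nonneg M
  have h3 : (θ₂ - θ₁) * (S₂ - S₁) ≥ 0 := by nlinarith
  have h4 : S₁ ≤ S₂ := by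
    by_contra hcon
    push Not at hcon
    have : (θ₂ - θ₁) * (S₂ - S₁) < 0 := mul_neg_of_pos_of_neg (by linarith) (by linarith)
    linarith
  have e1 : ((∑ i, d (p₁.2 i) : ℕ) : ℤ) = S₁ := by rw [hS₁]; push_cast; rfl
  have e2 : ((∑ i, d (p₂.2 i) : ℕ) : ℤ) = S₂ := by rw [hS₂]; push_cast; rfl
  exact_mod_cast (e1 ▸ e2 ▸ h4 : ((∑ i, d (p₁.2 i) : ℕ) : ℤ) ≤ ((∑ i, d (p₂.2 i) : ℕ) : ℤ))

/-! ## Rescaling the valuations (appendix, g9): fractional tie slopes become integer slopes at a smaller base -/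

/-- **Valuation rescaling does not change the pencil.**  The design `(d, n·v, ε)` patchworked at base `c` IS the design `(d, v, ε)`
patchworked at base `c^n`: `patchMatrix c (n·v) ε = patchMatrix (c^n) v ε`.  Use: a pencil patchworked from `(d, v, ε)` at base
`b = c^n` whose envelope has tie / dominance slopes in `(1/n)ℤ` is the pencil of `(d, n·v, ε)` at base `c`, whose tie / dominance slopes
are INTEGERS, so the integer-slope window theorems of this toolbox (`…FiniteBasePatchwork`, `…FiniteBaseChordMargin`,
`…FiniteBaseChordChain`) apply with base `c` and margins measured in the rescaled (×`n`) units. [folklore] -/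
theorem patchMatrix_natMul_eq_pow (c : ℝ) (n : ℕ) (v ε : Fin m → Fin m → Fin K → ℤ) :
    patchMatrix c (fun i j l => (n : ℤ) * v i j l) ε = patchMatrix (c ^ n) v ε := by
  ext i j
  simp only [patchMatrix]
  congr 1
  rw [← zpow_natCast, ← zpow_mul, neg_mul_eq_mul_neg]

/-- the same rescaling for tropical weights: `tropWeight d (n·v) θ q = n · tropWeight d v (θ/n) q` in the form free of division —
`tropWeight d (n·v) (n·θ) q = n · tropWeight d v θ q`, so dominance with margin `M` at the integer slope `θ` for `(d, v, ε)` is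
dominance with margin `n·M` at `n·θ` for `(d, n·v, ε)`. [folklore] -/
theorem tropWeight_natMul (d : Fin K → ℕ) (v : Fin m → Fin m → Fin K → ℤ) (n : ℕ) (θ : ℤ)
    (q : Equiv.Perm (Fin m) × (Fin m → Fin K)) :
    tropWeight d (fun i j l => (n : ℤ) * v i j l) ((n : ℤ) * θ) q = (n : ℤ) * tropWeight d v θ q := by
  unfold tropWeight
  simp only [← Finset.mul_sum]
  ring

end Summit.ValiantsHypothesis.ValiantsHypothesis.Theorems.KPlusLogSqLaw.LocalDescartes
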